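import Literature.NumberTheory.EllipticCurves.CasselsTateSelmerKolyvaginValue
import Summits.BirchSwinnertonDyer.BirchSwinnertonDyer.Theorems.GenusKolyvaginAtTwoPowDvdShaCardAtTwoRTCrossSignLocalVanishing
import HarnessLib

/-!
# Route `GenusKolyvaginAtTwo`, crux L_T `PowDvdShaCardAtTwoRT` (stmt-BirchSwinnertonDyer-23299), LINE 18, road (E4) — socket X-ORTH, FIRST FILE:
# the pulled-back Cassels–Tate value of a pair `(z, t) = (m • b₁, t)` VANISHES when every local term of a first-case datum vanishes;
# the local terms in `invWeilPairing` currency; and the CROSS local term is `0` (level `m·m = 2^M`, deep inert Kolyvagin place)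

Seat `bsd-line-gk2-p4` g20 (WIDTH-5 attach, cell `bsd-f1-sign2`), `--supports` the crux L_T (helper; closes nothing).  THEOREMS ONLY (no
definition, no named fact, no `sorry`); BSD is not proved by any of this; neither is L_T nor any stub.

WHY (memo `Cruxes/PowDvdShaCardAtTwoRT/Lines/plus-descent-deep-orthogonality-gk2p4.md` §2–§4, §7).  X-ORTH = «the level-`m` Cassels–Tate pairing
of a (+)-rung and a (−)-rung Kolyvagin Ш-class is `0`»; with `…RTOrthogonalLadders` (p735742) it gives `2^{2M₀} ∣ #Ш(E_K)[2^∞]` K-side.  McCallum's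
Prop. 4.7 in the tree (`CasselsTateSelmerLocalValue` / `…KolyvaginValue`) isolates ONE surviving local term; X-ORTH needs the form «ALL local
terms vanish ⟹ the value vanishes», with the terms written in the currency of the LINE's local laws (`invWeilPairing`, `kummerSelmerStructure`,
`conjActPlace`) — the two dialects agree DEFINITIONALLY (`toLocal = restrictField`, `localization = res`, `weilLocalCup = cupProduct` of
`weilContPairingLocal`).
* §1 `firstCase_localTerm_eq_invWeilPairing` (`t_v(D) = inv_v((loc_v b₁ − β_v) ∪ₑ β′_v)`, by `rfl`), `…_eq_invWeilPairing_localization`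
  (`= inv_v(loc_v b₁ ∪ₑ β′_v)`: Kummer ⊥ Kummer).
* §2 `ctLevelPairing_pullback_eq_zero_of_forall_localTerm_eq_zero` — `B(ι z, ι t) = 0` as soon as every local term of ONE first-case datum `D`
  with `D.b₁ = b₁`, `ι_* D.b′ = t` vanishes on `D.badSet`; `…_of_forall_cases` — the McCallum case split: at each place `loc_v b₁ ∈ 𝓛_v`
  (`v ∤ n`) or `loc_v b′ = 0` (own primes of `t`) or the term is shown to vanish otherwise (the CROSS places).
* §3 `firstCase_localTerm_eq_zero_of_cross` — THE CROSS TERM IS ZERO: at a deep inert Kolyvagin place `λ` of the Heegner field (`Δ < 0`,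
  `m·m = 2^M`, `M ≤ index`, `FrobEqFrobInfty W K (2^M) ℓ`, `τ•λ = λ`, `e` lift-equivariant, `inv` conj-compatible), if `τ_* b₁ = s·b₁`,
  `m • loc_λ b₁ = 0` (`loc_λ z = 0`: own prime of the Ш-class `z`) and `β′_λ` is `(−s)`-eigen MODULO `m·𝓛_λ` (`σ_*β′_λ + s·β′_λ = m·Y′`, `Y′ ∈ 𝓛_λ` —
  the shape forced by `mulK β′_λ = loc_λ b′` with `b′` of sign `−s`), then `t_λ(D) = 0` (`…RTCrossSignLocalVanishing` §3, transported to the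
  level `m·m` by `subst`).
What X-ORTH still owes after this file (memo §4): the two naturality facts turning «`ι_* b′ = t`, `τ_* t = −s·t`» and «`mulK β′_λ = loc_λ b′`» into
the displayed eigen-modulo-`m` clause of §3 (`conjAct`/`conjActPlace` commute with `inclKD`/`mulK`, cf. `RelaxedCount.conjAct_torsionH1OfDvd`;
`ker mulK ∩ 𝓛^{(m²)} = m·𝓛^{(m²)}`), and the bookkeeping of the places of `n`, `n′` for the LINE's Kolyvagin classes.

References: [McCallumLMS1991] §4 Prop. 4.7, §5 Lemma 5.3, Thm. 5.4; [MilneADT2006] Ch. I §6 proof of Prop. 6.9, Lemma 6.17;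
[Kolyvagin1991StructureSha].
-/

set_option autoImplicit false

noncomputable section

open scoped Classical
open scoped AddSubgroup
open Function Field NumberField IsDedekindDomain WeierstrassCurve
open Literature.NumberTheory.EllipticCurves Literature.NumberTheory.GaloisRepresentations
open Literature.NumberTheory.GaloisCohomology
open Literature.NumberTheory.GaloisRepresentations.DiscreteGaloisModule (mu)
open Literature.NumberTheory.Automorphic
open Summit.BirchSwinnertonDyer.Rank1Residual.X11b.Relaxation
open Summit.BirchSwinnertonDyer.Rank1Residual.JET.GlobalDuality

-- the Theorems namespace of this sub repeats the summit name by design (D-0017 nested layout)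
set_option linter.dupNamespace false

universe u

namespace Summit.BirchSwinnertonDyer.BirchSwinnertonDyer.Theorems.GenusExact.PlusDescent

/-! ## §1 The local terms of a first-case datum in `invWeilPairing` currency -/

section LocalTerms

variable {K : Type u} [Field K] [NumberField K] {W : WeierstrassCurve K} {m : ℕ} [NeZero m]
variable (e : geomTorsion W ((m * m : ℕ) : ℤ) → geomTorsion W ((m * m : ℕ) : ℤ) → AlgebraicClosure K)
  (hμ : ∀ S T, e S T ^ (m * m) = 1)
  (hadd₁ : ∀ S₁ S₂ T, e (S₁ + S₂) T = e S₁ T * e S₂ T)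
  (hadd₂ : ∀ S T₁ T₂, e S (T₁ + T₂) = e S T₁ * e S T₂)
  (hgal : ∀ (σ : absoluteGaloisGroup K) (S T : geomTorsion W ((m * m : ℕ) : ℤ)), σ • e S T = e (σ • S) (σ • T))
  (halt : ∀ T, e T T = 1)
variable (inv : LocalInvariants K (m * m))

/-- **The local term is `inv_v((loc_v b₁ − β_v) ∪ₑ β′_v)`** in the currency of the LINE's local laws (`invWeilPairing` of
`X11b.BDPRouteRelaxation`; `DiscreteGaloisModule.toLocal v = GaloisRep.restrictField (K_v)` and `weilLocalCup = ` the cup product of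
`weilContPairingLocal`, definitionally). [cite: MilneADT2006, Ch. I §6, proof of Prop. 6.9] -/
theorem firstCase_localTerm_eq_invWeilPairing [NeZero (m * m)] (D : FirstCaseData W m) (v : Place K) :
    D.localTerm e hμ hadd₁ hadd₂ hgal inv v =
      invWeilPairing W (m * m) e hμ hadd₁ hadd₂ hgal inv v
        (galoisCohomology.localization (W.torsionGaloisModule ((m * m : ℕ) : ℤ)) v 1 D.b₁ -
          (show galoisCohomology ((W.torsionGaloisModule ((m * m : ℕ) : ℤ)).toLocal v) 1 from D.β v)) (D.β' v) := by
  -- cup products need `LocallyCompactSpace Γ_{K_v}` (compactness of the absolute Galois group, a `haveI` as in the tree's files)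
  haveI := absoluteGaloisGroup_compactSpace (Place.Completion v)
  rw [invWeilPairing_apply]
  rfl

include halt in
/-- **The local term is `inv_v(loc_v b₁ ∪ₑ β′_v)`**: the Kummer lift `β_v` pairs to zero with the Kummer class `β′_v` (isotropy of `𝓛_v`,
tree `invWeilPairing_eq_zero_of_mem`). [cite: MilneADT2006, Ch. I §6, proof of Prop. 6.9] [cite: McCallumLMS1991, §4 Prop. 4.7] -/
theorem firstCase_localTerm_eq_invWeilPairing_localization [NeZero (m * m)] [W.IsElliptic] (D : FirstCaseData W m)
    (v : Place K) :
    D.localTerm e hμ hadd₁ hadd₂ hgal inv v =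
      invWeilPairing W (m * m) e hμ hadd₁ hadd₂ hgal inv v
        (galoisCohomology.localization (W.torsionGaloisModule ((m * m : ℕ) : ℤ)) v 1 D.b₁) (D.β' v) := by
  rw [firstCase_localTerm_eq_invWeilPairing e hμ hadd₁ hadd₂ hgal inv D v, map_sub, AddMonoidHom.sub_apply,
    invWeilPairing_eq_zero_of_mem W (m * m) e hμ hadd₁ hadd₂ hgal halt inv v (D.β_mem v) (D.β'_mem v), sub_zero]

end LocalTerms

/-! ## §2 The pulled-back Cassels–Tate value vanishes when all local terms do -/

section Vanishing

variable {K : Type u} [Field K] [NumberField K] {W : WeierstrassCurve K} {m : ℕ} [NeZero m]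
variable (e : geomTorsion W ((m * m : ℕ) : ℤ) → geomTorsion W ((m * m : ℕ) : ℤ) → AlgebraicClosure K)
  (hμ : ∀ S T, e S T ^ (m * m) = 1)
  (hadd₁ : ∀ S₁ S₂ T, e (S₁ + S₂) T = e S₁ T * e S₂ T)
  (hadd₂ : ∀ S T₁ T₂, e S (T₁ + T₂) = e S T₁ * e S T₂)
  (hgal : ∀ (σ : absoluteGaloisGroup K) (S T : geomTorsion W ((m * m : ℕ) : ℤ)), σ • e S T = e (σ • S) (σ • T))
variable (inv : LocalInvariants K (m * m))
-- `hPT'` is the reciprocity predicate `LocalInvariants.SumInvLocalizationEqZero` on `inv`, not a named fact.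
variable (halt : ∀ T, e T T = 1) (hPT' : inv.SumInvLocalizationEqZero)
  (hH3 : ∀ c : galoisCohomology (mu K (m * m)) 3,
    (∀ v : Place K, galoisCohomology.localization (mu K (m * m)) v 3 c = 0) → c = 0)
  (hfin : ∀ D : GeneralCaseData W m e hμ hadd₁ hadd₂ hgal, ∃ S : Finset (Place K), ∀ v ∉ S, D.localTerm inv v = 0)
variable (ι : selmerGroup W ((m * m : ℕ) : ℤ) →+ (W.sha)[m])
  (hι : ∀ z, shaTorsionVal W m (ι z) = torsionH1ToH1 W ((m * m : ℕ) : ℤ) z)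

include halt hPT' hι in
/-- **`B(ι z, ι t) = 0` when every local term vanishes.**  For Selmer classes `z = m • b₁`, `t` at level `m²` and ANY first-case datum `D` with
`D.b₁ = b₁`, `ι_* D.b′ = t`: if `t_v(D) = 0` for every `v` in the exceptional set `D.badSet`, then the pulled-back level-`m` Cassels–Tate value
`B(ι z, ι t)` (`B = ctLevelPairing`) is `0` (`ctLevelPairing_pullback_apply` + `ctGeneralFun_zsmul_eq_value`: the value is the SUM of the local
terms). [cite: MilneADT2006, Ch. I §6, proof of Prop. 6.9] [cite: McCallumLMS1991, §4 Prop. 4.7] -/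
theorem ctLevelPairing_pullback_eq_zero_of_forall_localTerm_eq_zero [W.IsElliptic] (z t : selmerGroup W ((m * m : ℕ) : ℤ))
    {b₁ : galoisCohomology (W.torsionGaloisModule ((m * m : ℕ) : ℤ)) 1} (hz : (z : galH1Torsion W ((m * m : ℕ) : ℤ)) = (m : ℤ) • b₁)
    (D : FirstCaseData W m) (hD₁ : D.b₁ = b₁)
    (hDt : galoisCohomology.map (inclKD W m m) 1 D.b' = (t : galH1Torsion W ((m * m : ℕ) : ℤ)))
    (h0 : ∀ v ∈ D.badSet, D.localTerm e hμ hadd₁ hadd₂ hgal inv v = 0) :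
    ctLevelPairing W m e hμ hadd₁ hadd₂ hgal inv halt hPT' hH3 hfin (ι z) (ι t) = 0 := by
  rw [ctLevelPairing_pullback_apply e hμ hadd₁ hadd₂ hgal inv halt hPT' hH3 hfin ι hι, hz, ← hDt, torsionH1ToH1_map_inclKD, ← hD₁,
    ctGeneralFun_zsmul_eq_value inv halt hPT' D, FirstCaseData.value, Finset.sum_eq_zero h0, map_zero]

include halt hPT' hι in
/-- **McCallum's case split, vanishing form.**  Same `z = m • b₁`, `t`, `D`; suppose that at every place either `loc_v b₁ ∈ 𝓛_v^{(m²)}`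
(`v ∤ n`: Lemma 4.3 / Gross 6.2 with odd Tamagawa) or `loc_v b′ = 0` (the own primes of `t`) or the local term is known to vanish (the CROSS
places, §3).  Then `B(ι z, ι t) = 0`. [cite: McCallumLMS1991, §4 Prop. 4.7] [cite: MilneADT2006, Ch. I §6, proof of Prop. 6.9] -/
theorem ctLevelPairing_pullback_eq_zero_of_forall_cases [W.IsElliptic] (z t : selmerGroup W ((m * m : ℕ) : ℤ))
    {b₁ : galoisCohomology (W.torsionGaloisModule ((m * m : ℕ) : ℤ)) 1} (hz : (z : galH1Torsion W ((m * m : ℕ) : ℤ)) = (m : ℤ) • b₁)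
    (D : FirstCaseData W m) (hD₁ : D.b₁ = b₁)
    (hDt : galoisCohomology.map (inclKD W m m) 1 D.b' = (t : galH1Torsion W ((m * m : ℕ) : ℤ)))
    (h : ∀ v : Place K,
      galoisCohomology.res (W.torsionGaloisModule ((m * m : ℕ) : ℤ)) (Place.Completion v) 1 b₁ ∈
          W.kummerLocalConditionAt ((m * m : ℕ) : ℤ) (Place.Completion v) ∨
        galoisCohomology.res (W.torsionGaloisModule (m : ℤ)) (Place.Completion v) 1 D.b' = 0 ∨
          D.localTerm e hμ hadd₁ hadd₂ hgal inv v = 0) :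
    ctLevelPairing W m e hμ hadd₁ hadd₂ hgal inv halt hPT' hH3 hfin (ι z) (ι t) = 0 := by
  refine ctLevelPairing_pullback_eq_zero_of_forall_localTerm_eq_zero e hμ hadd₁ hadd₂ hgal inv halt hPT' hH3 hfin ι hι z t hz D hD₁ hDt
    fun v _ ↦ ?_
  rcases h v with h₁ | h₂ | h₃
  · exact D.localTerm_eq_zero_of_res_b₁_mem inv (GeneralCaseData.hiso_of_fact (hgal := hgal) halt) (hD₁ ▸ h₁)
  · exact D.localTerm_eq_zero_of_res_b'_eq_zero inv h₂
  · exact h₃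

end Vanishing

/-! ## §3 The CROSS local term vanishes (level `m·m = 2^M`, deep inert Kolyvagin place of the Heegner field) -/

section Cross

variable (W : WeierstrassCurve ℚ) (K : Type) [Field K] [NumberField K] [W.IsElliptic] [W.IsGloballyMinimal]

/-- `…RTCrossSignLocalVanishing` §3 transported to a level `N = 2^M` given as a variable (so that it applies VERBATIM at the Cassels–Tate
level `N = m·m`). [cite: McCallumLMS1991, §5 Lemma 5.3] -/
theorem invWeilPairing_kummer_localization_eq_zero_of_conjActPlace_add_zsmul_eq_of_level_eq {N : ℕ} [NeZero N] {M : ℕ}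
    (hN : N = 2 ^ M)
    (hK : IsImaginaryQuadratic K) (hΔ : W.Δ < 0) {ℓ : ℕ} (hM : 1 ≤ M)
    (hℓ : Zhang2014.IsKolyvaginPrime (W.conductorNorm ℤ) W K 2 ℓ) (hk : M ≤ Zhang2014.kolyvaginIndex W 2 ℓ)
    (hF : FrobEqFrobInfty W K (2 ^ M) ℓ) (w : HeightOneSpectrum (𝓞 K)) (hw : (ℓ : 𝓞 K) ∈ w.asIdeal)
    {τ : K ≃ₐ[ℚ] K} (hτ1 : τ ≠ 1) (hττ : τ * τ = 1) (hfix : τ • w = w)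
    (e : (W.baseChange K).geomTorsion ((N : ℕ) : ℤ) → (W.baseChange K).geomTorsion ((N : ℕ) : ℤ) → AlgebraicClosure K)
    (hμ : ∀ S T, e S T ^ N = 1)
    (hadd₁ : ∀ S₁ S₂ T, e (S₁ + S₂) T = e S₁ T * e S₂ T)
    (hadd₂ : ∀ S T₁ T₂, e S (T₁ + T₂) = e S T₁ * e S T₂)
    (hgal : ∀ (γ : absoluteGaloisGroup K) (S T : (W.baseChange K).geomTorsion ((N : ℕ) : ℤ)), γ • e S T = e (γ • S) (γ • T))
    (halt : ∀ T, e T T = 1)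
    (hte : ∀ S T, e ((isLiftOfAut_liftAutPlace τ hfix).torsionMap W ((N : ℕ) : ℤ) S)
      ((isLiftOfAut_liftAutPlace τ hfix).torsionMap W ((N : ℕ) : ℤ) T) = liftAutPlace τ hfix (e S T))
    (inv : LocalInvariants K N) (hinvc : inv.IsConjCompatible τ)
    {x : galoisCohomology ((W.baseChange K).torsionGaloisModule ((N : ℕ) : ℤ)) 1} {s q : ℤ}
    (hx : conjAct W τ ((N : ℕ) : ℤ) x = s • x)
    (hqx : q • galoisCohomology.localization ((W.baseChange K).torsionGaloisModule ((N : ℕ) : ℤ)) (Sum.inr w : Place K) 1 x = 0)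
    {Y Y' : galoisCohomology (((W.baseChange K).torsionGaloisModule ((N : ℕ) : ℤ)).toLocal (Sum.inr w : Place K)) 1}
    (hY : Y ∈ (W.baseChange K).kummerSelmerStructure ((N : ℕ) : ℤ) (Sum.inr w))
    (hY' : Y' ∈ (W.baseChange K).kummerSelmerStructure ((N : ℕ) : ℤ) (Sum.inr w))
    (hσY : conjActPlace W τ ((N : ℕ) : ℤ) hfix Y + s • Y = q • Y') :
    invWeilPairing (W.baseChange K) N e hμ hadd₁ hadd₂ hgal inv (Sum.inr w) Y
        (galoisCohomology.localization ((W.baseChange K).torsionGaloisModule ((N : ℕ) : ℤ)) (Sum.inr w : Place K) 1 x) = 0 ∧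
      invWeilPairing (W.baseChange K) N e hμ hadd₁ hadd₂ hgal inv (Sum.inr w)
        (galoisCohomology.localization ((W.baseChange K).torsionGaloisModule ((N : ℕ) : ℤ)) (Sum.inr w : Place K) 1 x) Y = 0 := by
  subst hN
  exact invWeilPairing_kummer_localization_eq_zero_of_conjActPlace_add_zsmul_eq W K hK hΔ hM hℓ hk hF w hw hτ1 hττ hfix e hμ hadd₁
    hadd₂ hgal halt hte inv hinvc hx hqx hY hY' hσY

/-- **THE CROSS LOCAL TERM IS ZERO.**  Cassels–Tate level `m` with `m·m = 2^M`; `λ ∋ ℓ` a deep inert Kolyvagin place of the Heegner field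
(`Δ < 0`, `1 ≤ M ≤ M(ℓ)`, `FrobEqFrobInfty W K (2^M) ℓ`, `τ•λ = λ`; `e` lift-equivariant, `inv` conj-compatible); a first-case datum `D` whose
global lift `b₁` is a `τ_*`-eigenclass of sign `s` with `m • loc_λ b₁ = 0` (own prime of the Ш-class `z = m • b₁`) and whose Kummer lift `β′_λ`
is `(−s)`-eigen modulo `m·𝓛_λ` (`σ_*β′_λ + s·β′_λ = m·Y′`, `Y′ ∈ 𝓛_λ`).  Then `t_λ(D) = 0` — the term of McCallum's Prop. 4.7 at a prime of the
FIRST class that does not divide the level of the second, for classes of OPPOSITE depth parity. [cite: McCallumLMS1991, §4 Prop. 4.7, §5 Lemma 5.3]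
[cite: Howard2004HeegnerKolyvagin, Lemma 1.5.3] -/
theorem firstCase_localTerm_eq_zero_of_cross {m M : ℕ} [NeZero m] [NeZero (m * m)] (hmm : m * m = 2 ^ M)
    (hK : IsImaginaryQuadratic K) (hΔ : W.Δ < 0) {ℓ : ℕ} (hM : 1 ≤ M)
    (hℓ : Zhang2014.IsKolyvaginPrime (W.conductorNorm ℤ) W K 2 ℓ) (hk : M ≤ Zhang2014.kolyvaginIndex W 2 ℓ)
    (hF : FrobEqFrobInfty W K (2 ^ M) ℓ) (w : HeightOneSpectrum (𝓞 K)) (hw : (ℓ : 𝓞 K) ∈ w.asIdeal)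
    {τ : K ≃ₐ[ℚ] K} (hτ1 : τ ≠ 1) (hττ : τ * τ = 1) (hfix : τ • w = w)
    (e : (W.baseChange K).geomTorsion ((m * m : ℕ) : ℤ) → (W.baseChange K).geomTorsion ((m * m : ℕ) : ℤ) → AlgebraicClosure K)
    (hμ : ∀ S T, e S T ^ (m * m) = 1)
    (hadd₁ : ∀ S₁ S₂ T, e (S₁ + S₂) T = e S₁ T * e S₂ T)
    (hadd₂ : ∀ S T₁ T₂, e S (T₁ + T₂) = e S T₁ * e S T₂)
    (hgal : ∀ (γ : absoluteGaloisGroup K) (S T : (W.baseChange K).geomTorsion ((m * m : ℕ) : ℤ)), γ • e S T = e (γ • S) (γ • T))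
    (halt : ∀ T, e T T = 1)
    (hte : ∀ S T, e ((isLiftOfAut_liftAutPlace τ hfix).torsionMap W ((m * m : ℕ) : ℤ) S)
      ((isLiftOfAut_liftAutPlace τ hfix).torsionMap W ((m * m : ℕ) : ℤ) T) = liftAutPlace τ hfix (e S T))
    (inv : LocalInvariants K (m * m)) (hinvc : inv.IsConjCompatible τ)
    (D : FirstCaseData (W.baseChange K) m) {s : ℤ}
    (hb₁ : conjAct W τ ((m * m : ℕ) : ℤ) D.b₁ = s • D.b₁)
    (hmb₁ : (m : ℤ) • galoisCohomology.localization ((W.baseChange K).torsionGaloisModule ((m * m : ℕ) : ℤ)) (Sum.inr w : Place K) 1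
      D.b₁ = 0)
    {βw Y' : galoisCohomology (((W.baseChange K).torsionGaloisModule ((m * m : ℕ) : ℤ)).toLocal (Sum.inr w : Place K)) 1}
    (hβw : βw = D.β' (Sum.inr w))
    (hY' : Y' ∈ (W.baseChange K).kummerSelmerStructure ((m * m : ℕ) : ℤ) (Sum.inr w))
    (hσβ' : conjActPlace W τ ((m * m : ℕ) : ℤ) hfix βw + s • βw = (m : ℤ) • Y') :
    D.localTerm e hμ hadd₁ hadd₂ hgal inv (Sum.inr w) = 0 := by
  have hβmem : βw ∈ (W.baseChange K).kummerSelmerStructure ((m * m : ℕ) : ℤ) (Sum.inr w) := hβw ▸ D.β'_mem (Sum.inr w)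
  rw [firstCase_localTerm_eq_invWeilPairing_localization e hμ hadd₁ hadd₂ hgal halt inv D (Sum.inr w)]
  have h := (invWeilPairing_kummer_localization_eq_zero_of_conjActPlace_add_zsmul_eq_of_level_eq W K hmm hK hΔ hM hℓ hk hF w hw hτ1
    hττ hfix e hμ hadd₁ hadd₂ hgal halt hte inv hinvc hb₁ hmb₁ hβmem hY' hσβ').2
  rwa [hβw] at h

end Cross

end Summit.BirchSwinnertonDyer.BirchSwinnertonDyer.Theorems.GenusExact.PlusDescent

end
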